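import Summits.Parity.GeneralizedHardyLittlewood.Theses.LiouvilleShiftedTables
import Summits.Parity.GeneralizedHardyLittlewood.Theses.LiouvilleMAD
import Summits.Parity.GeneralizedHardyLittlewood.Theorems.ElliottHalberstam.Negative.ElliottHalberstamFixedResidue
import Summits.Parity.GeneralizedHardyLittlewood.Theorems.ElliottHalberstam.Negative.ElliottHalberstamStructure
import Summits.Parity.GeneralizedHardyLittlewood.Theorems.LiouvilleShiftedTablesEHLevelClosure
import Literature.NumberTheory.Sieve.LevelOfDistribution

/-!
# STRATEGY-CENSUS companion — crux stmt-Parity-14985 `ElliottHalberstamCond` (typed signatures)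

Wall-breaker crux-strategist `planner-cstrat-stmt-Parity-14985-p1-0`, 2026-08-17.  This file contains NO
attack on the crux and asserts nothing open: it TYPES (over existing declarations, `lean check` rc 0,
no `sorry`) the statements that the prose census `STRATEGY-CENSUS.md` examines under its four mandatory
headings, so that "stated as a signature" is literal and the next seat can import them:

* §0  the crux is the Elliott–Halberstam conjecture BY NAME (`rfl` for both route decls);
* §S  STRENGTHEN: `MontgomeryUniform` (S1), `GEHAll` (S2), `ErrorLogFlat` (S3) — each strictly
      above the crux, none with usable rigidity (census §4);
* §D  DECOMPOSITION: `DivisorSupA k θ` + `WindowedTypeIISupA θ ν₁ ν₂` (D1, Heath-Brown split;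
      `windowedTypeIISupA_of_geh` certifies that the Type-II piece IS a GEH fragment),
      `FixedClassLevel` / `EquiAmongClasses` (D2, residue split) (census §5);
* §R  the ROUTE-LEVEL door (not a crux-level output; for the human / tenure planner): the premises the
      proved glue actually consumes — `EHLogTwo` (literally what `PairsFromMAvg_proof` instantiates:
      `A = 2`, every `θ < 1`), `FixedClassEH b` (one class, `sup_y` kept), and the landed one-height
      form `ElliottHalberstamFixedResidue h` — with the trivial implications FROM the crux;
* §N  NEGATION: where a counterexample must live (`θ ∈ (1/2,1)`, landed p106857), re-instantiated.
-/

namespace Summit.Parity.GeneralizedHardyLittlewood.Cruxes.ElliottHalberstamCond.StrategyCensus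

open Filter Asymptotics Finset
open Literature.NumberTheory.Sieve Literature.NumberTheory.Sieve.LevelOfDistribution
open scoped ArithmeticFunction.sigma

/-! ## §0 The crux by name -/

/-- The crux decl of route LiouvilleShiftedTables is the Literature constant (the EH conjecture). -/
example : Summit.Parity.GeneralizedHardyLittlewood.Theses.LiouvilleShiftedTables.ElliottHalberstamCond =
    Literature.NumberTheory.Sieve.LevelOfDistribution.ElliottHalberstam := rfl

/-- … and so is the crux decl of route LiouvilleMAD (the item is shared). -/
example : Summit.Parity.GeneralizedHardyLittlewood.Theses.LiouvilleMAD.ElliottHalberstamCond =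
    Literature.NumberTheory.Sieve.LevelOfDistribution.ElliottHalberstam := rfl

/-- Local name for the crux. -/
abbrev Crux : Prop := Literature.NumberTheory.Sieve.LevelOfDistribution.ElliottHalberstam

/-! ## §S STRENGTHEN — candidate `S⁺` statements (each implies the crux on paper; none is filed) -/

/-- **S1 — Montgomery's uniform conjecture** (pointwise power saving, uniform in `q ≤ x` and in the
class): `|ψ(x;q,a) − x/φ(q)| ≤ C_ε x^{1/2+ε} q^{−1/2}`.  Summing over `q ≤ x^{θ−ε'}` gives the crux with a
POWER saving; it contains GRH (`q = 1`) plus cross-character cancellation; in its original uniformity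
(`q ≤ x`) it is refuted near `q = x^{1−o(1)}` (Friedlander–Granville 1989; tree
`FriedlanderGranvilleUniformityBarrier`).  No inductive parameter: rigidity buys nothing (census §4). -/
def MontgomeryUniform : Prop :=
  ∀ ε : ℝ, 0 < ε → ∃ C : ℝ, ∀ x : ℝ, 2 ≤ x → ∀ q : ℕ, 1 ≤ q → (q : ℝ) ≤ x →
    ∀ a : (ZMod q)ˣ,
      |chebyshevPsiMod q (a : ZMod q) x - x / Nat.totient q| ≤ C * x ^ (1 / 2 + ε) / Real.sqrt q

/-- **S2 — GEH for every `θ < 1`** (Polymath 8b Claim 2.6 shape, tree `GeneralizedElliottHalberstam`).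
The added rigidity (closure of bilinear forms under Heath-Brown/Vaughan decompositions) buys the
REDUCTION of the crux to bilinear estimates, not the estimate: with `sup_a` inside, GEH[θ] is open for
every `θ > 1/2` for the same large-sieve reason as the crux (census §4, §5 D1). -/
def GEHAll : Prop := ∀ θ : ℝ, θ < 1 → GeneralizedElliottHalberstam θ

/-- `ℓ²`-average (root mean square over the reduced classes, as a plain `Finset` sum over
`a < q, (a,q) = 1`) of the prime-AP error at the single height `x`. -/
noncomputable def errRMS (x : ℝ) (q : ℕ) : ℝ :=
  Real.sqrt (((Nat.totient q : ℝ))⁻¹ *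
    ∑ a ∈ (range q).filter (fun a : ℕ => a.Coprime q),
      (chebyshevPsiMod q (a : ZMod q) x - x / Nat.totient q) ^ 2)

/-- `ℓ^∞` (sup over reduced classes) of the prime-AP error at the single height `x`. -/
noncomputable def errSup (x : ℝ) (q : ℕ) : ℝ :=
  ⨆ a : (ZMod q)ˣ, |chebyshevPsiMod q (a : ZMod q) x - x / Nat.totient q|

/-- **S3 — log-flatness (delocalisation) of the error vector across classes**: for all but a
harmonically-negligible set of moduli `q ≤ x^θ`, `max_a |Δ(x;q,a)| ≤ (log x)^B · rms_a Δ(x;q,·)`.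
With the Barban–Davenport–Halberstam UPPER bound (known, large sieve) and Brun–Titchmarsh on the
exceptional moduli this gives `PrimesHaveLevel θ` at the height `x` (Cauchy–Schwarz; census §4 S3) —
but it is Montgomery's conjecture at log precision ("no class is preferred"), with no tool: the zero
side enters only through `φ(q)^{-1} Σ_χ |ψ(x,χ)|`, i.e. level `1/2` exactly. -/
def ErrorLogFlat (θ : ℝ) : Prop :=
  ∃ B : ℝ, ∀ A : ℝ, 0 < A → ∀ᶠ x : ℝ in atTop,
    ∑ q ∈ (Icc 1 ⌊x ^ θ⌋₊).filter (fun q : ℕ => Real.log x ^ B * errRMS x q < errSup x q),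
      ((Nat.totient q : ℝ))⁻¹ ≤ 1 / Real.log x ^ A

/-! ## §D DECOMPOSITION — the best typed splits (pieces typed; which piece is the crux: census §5) -/

/-- **D1a — `d_k` in arithmetic progressions to level `x^θ`, sup over classes** (the Type-`I_k`
piece of a Heath-Brown/Linnik-identity split; `d_k = ζ^k` as Mathlib's Dirichlet power, discrepancy
= Polymath's `apDiscrepancy`).  Known: `k = 2` level `2/3` (Linnik–Selberg–Hooley, Weil bound),
`k = 3` level `1/2 + 1/46` at prime moduli (Fouvry–Kowalski–Michel, arXiv:1304.3199, Thm 1.1);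
`k ≥ 4`: nothing beyond `1/2` ("the only other case … is `d_3`", ibid. p.3).  Open for every `k ≥ 2`
as `θ → 1`. -/
def DivisorSupA (k : ℕ) (θ : ℝ) : Prop :=
  ∀ A : ℝ, 0 < A → ∀ ε : ℝ, 0 < ε →
    (fun x : ℝ => ∑ q ∈ Icc 1 ⌊x ^ (θ - ε)⌋₊,
        ⨆ a : (ZMod q)ˣ,
          |apDiscrepancy (fun n => (((ArithmeticFunction.zeta ^ k : ArithmeticFunction ℕ) n : ℕ) : ℝ))
              ⌊x⌋₊ q a|) =O[atTop]
      fun x : ℝ => x / Real.log x ^ A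

/-- **D1b — windowed Type II with the sup over classes** (GEH[θ] with the first factor confined to the
window `x^{ν₁} ≤ N ≤ x^{ν₂}`; in the Heath-Brown split of the crux the window is
`[x^{1−θ−ε}, x^{1−θ−ε+1/K₀}]`).  Binders copied from the tree's `GeneralizedElliottHalberstam`. -/
def WindowedTypeIISupA (θ ν₁ ν₂ : ℝ) : Prop :=
  ∀ ε : ℝ, 0 < ε → ∀ A : ℝ, 0 < A → ∀ k : ℕ, ∀ K : ℝ, 1 ≤ K → ∀ N M : ℝ → ℝ,
    ∀ α β : ℝ → ArithmeticFunction ℝ,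
    (∀ᶠ x in atTop, x ^ ν₁ ≤ N x ∧ N x ≤ x ^ ν₂ ∧ x ^ ε ≤ M x ∧ M x ≤ x ^ (1 - ε)) →
    (∃ C : ℝ, 1 ≤ C ∧ ∀ᶠ x in atTop, x / C ≤ N x * M x ∧ N x * M x ≤ C * x) →
    (∀ x, ∀ n : ℕ, (n : ℝ) < N x ∨ K * N x < n → α x n = 0) →
    (∀ x, ∀ n : ℕ, (n : ℝ) < M x ∨ K * M x < n → β x n = 0) →
    (∀ᶠ x in atTop, ∀ n : ℕ, |α x n| ≤ (σ 0 n : ℝ) ^ k * Real.log x ^ k ∧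
      |β x n| ≤ (σ 0 n : ℝ) ^ k * Real.log x ^ k) →
    (∀ B : ℝ, 0 < B → ∃ C : ℝ, ∀ᶠ x in atTop, ∀ q r : ℕ, 1 ≤ q → 1 ≤ r → ∀ a : (ZMod q)ˣ,
      |apDiscrepancy (fun n => if n.Coprime r then β x n else 0) ⌊K * M x⌋₊ q a| ≤
        C * (σ 0 (q * r) : ℝ) ^ k * M x / Real.log x ^ B) →
    (fun x : ℝ => ∑ q ∈ Icc 1 ⌊x ^ θ⌋₊,
        ⨆ a : (ZMod q)ˣ,
          |apDiscrepancy (fun n => (α x * β x) n) ⌊K * K * (N x * M x)⌋₊ q a|) =O[atTop]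
      fun x : ℝ => x / Real.log x ^ A

/-- **D1b is a GEH fragment (kernel-checked direction)**: GEH[θ] implies the windowed Type-II
statement for every window `[x^{ν₁}, x^{ν₂}]` with `0 < ν₁`, `ν₂ < 1` (shrink GEH's `ε`). -/
theorem windowedTypeIISupA_of_geh {θ ν₁ ν₂ : ℝ} (hν₁ : 0 < ν₁) (hν₂ : ν₂ < 1)
    (h : GeneralizedElliottHalberstam θ) : WindowedTypeIISupA θ ν₁ ν₂ := by
  intro ε hε A hA k K hK N M α β hwin hNM hα hβ hdiv hSW
  set ε' : ℝ := min ε (min ν₁ (1 - ν₂)) with hε'def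
  have hε' : 0 < ε' := lt_min hε (lt_min hν₁ (by linarith))
  have hε'ε : ε' ≤ ε := min_le_left _ _
  have hε'ν₁ : ε' ≤ ν₁ := (min_le_right _ _).trans (min_le_left _ _)
  have hε'ν₂ : ε' ≤ 1 - ν₂ := (min_le_right _ _).trans (min_le_right _ _)
  refine h ε' hε' A hA k K hK N M α β ?_ hNM hα hβ hdiv hSW
  filter_upwards [hwin, eventually_ge_atTop (1 : ℝ)] with x hx hx1
  obtain ⟨h1, h2, h3, h4⟩ := hx
  refine ⟨?_, ?_, ?_, ?_⟩
  · exact (Real.rpow_le_rpow_of_exponent_le hx1 hε'ν₁).trans h1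
  · exact h2.trans (Real.rpow_le_rpow_of_exponent_le hx1 (by linarith))
  · exact (Real.rpow_le_rpow_of_exponent_le hx1 hε'ε).trans h3
  · exact h4.trans (Real.rpow_le_rpow_of_exponent_le hx1 (by linarith))

/-- **D2a — one FIXED integer class `b`, coprime moduli, sup over heights kept**: the fixed-residue
level of distribution (BFI's setting; what Bombieri's asymptotic sieve consumes at `b = h`). -/
def FixedClassLevel (b : ℤ) (θ : ℝ) : Prop :=
  ∀ A : ℝ, 0 < A → ∀ ε : ℝ, 0 < ε →
    (fun x : ℝ => ∑ q ∈ (Icc 1 ⌊x ^ (θ - ε)⌋₊).filter (fun q : ℕ => IsCoprime (q : ℤ) b),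
        ⨆ y : Set.Icc (1 : ℝ) x,
          |chebyshevPsiMod q (b : ZMod q) y - (y : ℝ) / Nat.totient q|) =O[atTop]
      fun x : ℝ => x / Real.log x ^ A

/-- Fixed-class Elliott–Halberstam at the class `b`: level `x^θ` for every `θ < 1`. -/
def FixedClassEH (b : ℤ) : Prop := ∀ θ : ℝ, θ < 1 → FixedClassLevel b θ

/-- **D2b — equidistribution AMONG the reduced classes, main-term free**: on `ℓ¹`-average over
`q ≤ x^{θ−ε}`, `sup_y max_{a,b} |ψ(y;q,a) − ψ(y;q,b)|` is small.  Crux ⇒ D2b (triangle inequality) and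
D2b ⇒ crux (sum over `b`: `φ(q)ψ(y;q,a) − Σ_b ψ(y;q,b) = φ(q)ψ(y;q,a) − ψ(y) + O(ω(q) log y)`, then
PNT) — so D2b is the crux reworded and D2a is decoration in the split `D2a ∧ D2b ⇒ crux`
(census §5 D2). -/
def EquiAmongClasses (θ : ℝ) : Prop :=
  ∀ A : ℝ, 0 < A → ∀ ε : ℝ, 0 < ε →
    (fun x : ℝ => ∑ q ∈ Icc 1 ⌊x ^ (θ - ε)⌋₊,
        ⨆ y : Set.Icc (1 : ℝ) x, ⨆ a : (ZMod q)ˣ, ⨆ b : (ZMod q)ˣ,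
          |chebyshevPsiMod q (a : ZMod q) y - chebyshevPsiMod q (b : ZMod q) y|) =O[atTop]
      fun x : ℝ => x / Real.log x ^ A

/-! ## §R The ROUTE-LEVEL door (for the human / tenure; the crux itself is fixed for this seat) -/

/-- **R1 — what the PROVED glue literally instantiates.** `PairsFromMAvg_proof`
(`Theorems/LiouvilleShiftedTablesPairsFromMAvg.lean:152–153`) uses the crux once, as
`hEH (1 − ε/2) _ 2 two_pos (ε/2) _`: level `x^{1−ε}` for every `ε > 0` (because the engine reach `ε₁`
of `MAvg` is existential), log-power `A = 2`, full `E*(x;d)` summed over `d ≤ N^{1−ε}` at one `x`.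
`EHLogTwo` is that premise verbatim (strictly weaker AS TYPED than the crux — one log power — but of
the same species: open for every level `> 1/2`). -/
def EHLogTwo : Prop :=
  ∀ θ : ℝ, θ < 1 → ∀ ε : ℝ, 0 < ε →
    (fun x : ℝ => ∑ q ∈ Icc 1 ⌊x ^ (θ - ε)⌋₊, primeAPError x q) =O[atTop]
      fun x : ℝ => x / Real.log x ^ (2 : ℝ)

/-- The crux gives R1 (instantiate `A = 2`). -/
theorem ehLogTwo_of_crux (h : Crux) : EHLogTwo := fun θ hθ ε hε => h θ hθ 2 two_pos ε hε

/-- **R2 — the fixed-class premise for all shifts** (what Bombieri's asymptotic sieve for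
`Λ(n)Λ(n+h)` needs: the single class `h (mod d)`, `(d,h) = 1`, heights `y ≤ x`). -/
def FixedClassEHAllShifts : Prop := ∀ h : ℕ, 1 ≤ h → FixedClassEH (h : ℤ)

/-- **R3 — the landed one-height fixed-residue form follows from the crux** (p120236,
`Negative/ElliottHalberstamFixedResidue.lean`; re-instantiated). -/
example (hE : Crux) (h : ℕ) :
    Summit.Parity.GeneralizedHardyLittlewood.Theorems.ElliottHalberstam.Negative.ElliottHalberstamFixedResidue h :=
  Summit.Parity.GeneralizedHardyLittlewood.Theorems.ElliottHalberstam.Negative.elliottHalberstamFixedResidue_of_elliottHalberstam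
    hE h

/-- … and it keeps `θ < 1` as load-bearing (landed): the re-bridge changes the NAME of the premise
(and what can be cited as partial progress), not the conditional status. -/
example {h : ℕ} (hh : 1 ≤ h) :
    ¬ ∀ θ : ℝ,
      Summit.Parity.GeneralizedHardyLittlewood.Theorems.ElliottHalberstam.Negative.PrimesHaveLevelFixedResidue h θ :=
  Summit.Parity.GeneralizedHardyLittlewood.Theorems.ElliottHalberstam.Negative.elliottHalberstamFixedResidue_false_without_ltOne
    hh

/-! ## §N NEGATION — where a counterexample must live (landed p106857, re-instantiated for this decl) -/

/-- `¬ crux ↔ ∃ θ ∈ (1/2, 1), ¬ PrimesHaveLevel θ`: a disproof must exhibit a positive log-power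
fraction of moduli of size `x^θ`, `θ > 1/2`, each with ONE reduced class off by a `(log x)^{−A}`
fraction of its mass — every known irregularity mechanism (Maier matrices, Friedlander–Granville
divisor switching, exceptional characters) is `x^{o(1)}`-local in `log(x/q)` or absorbed by Siegel
(census §6). -/
example : ¬ Summit.Parity.GeneralizedHardyLittlewood.Theses.LiouvilleShiftedTables.ElliottHalberstamCond ↔
    ∃ θ : ℝ, 1 / 2 < θ ∧ θ < 1 ∧ ¬ Literature.NumberTheory.Sieve.PrimesHaveLevel θ :=
  Summit.Parity.GeneralizedHardyLittlewood.Theorems.EH.LevelClosure.not_eh_iff_Ioo_half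

/-- The content of the crux is exactly the open interval: `crux ↔ ∀ θ ∈ (1/2,1), PrimesHaveLevel θ`
(the closed endpoint `1/2` is the tree's theorem `primesHaveLevel_half`). -/
example : Summit.Parity.GeneralizedHardyLittlewood.Theses.LiouvilleShiftedTables.ElliottHalberstamCond ↔
    ∀ θ : ℝ, 1 / 2 < θ → θ < 1 → Literature.NumberTheory.Sieve.PrimesHaveLevel θ :=
  Summit.Parity.GeneralizedHardyLittlewood.Theorems.EH.LevelClosure.eh_iff_Ioo_half

end Summit.Parity.GeneralizedHardyLittlewood.Cruxes.ElliottHalberstamCond.StrategyCensus
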